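import Literature.AlgebraicGeometry.Resolution.HuGammaSchemeResolution
import Literature.Computability.AlgebraicComplexity.DeterminantIrreducible
import Literature.AlgebraicGeometry.Resolution.RegularLocalRingsJacobian
import HarnessLib
import Summits.ResolutionOfSingularities.ResolutionOfSingularities.Theorems.UniversalCellsMatroidCellResResidueWitnessMinors
import Summits.ResolutionOfSingularities.ResolutionOfSingularities.Theorems.UniversalCellsMatroidCellResResidueWitnessCone

/-!
# The chart `D(a₀₀)` of the complete-quadrilateral Γ-scheme is the quadric cone (crux `UniversalCells.MatroidCellRes`)

Third of four files exhibiting a witness for the residue stub (N) of crux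
stmt-ResolutionOfSingularities-15230 (`UniversalCells.MatroidCellRes`, line `birth`). With `K` a
field, `2 ≠ 0`, `A₀ = [[1,1,1,0],[1,1,0,1],[1,0,1,1]]` and `Γ = {u | x_u(A₀) = 0}` (file
`…ResidueWitnessMinors.lean`), the CHART RING of the Γ-scheme at `a₀₀` is
`L = (K[A] ⧸ (x_u : u ∈ Γ))[1/a₀₀]`. On `D(a₀₀)` the six line relations solve
`a₀₃ = a₁₂ = a₂₁ = 0`, `a₁₁ = a₀₁a₁₀/a₀₀`, `a₂₂ = a₀₂a₂₀/a₀₀` and leave exactly the quadric cone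
`a₁₀a₂₃ = a₁₃a₂₀`:

* `nonempty_ringEquiv_away_cone_of`, `nonempty_ringEquiv_chart_cone` — `L ≃+* D`,
  `D = (K[y₀,…,y₆] ⧸ (y₃y₆ - y₄y₅))[1/y₀]` (`y = (a₀₀, a₀₁, a₀₂, a₁₀, a₁₃, a₂₀, a₂₃)`), by two
  explicit mutually inverse maps (`exists_ringHom_chart_to_cone`: `A ↦ [[y₀,y₁,y₂,0],
  [y₃,y₁y₃/y₀,0,y₄],[y₅,0,y₂y₅/y₀,y₆]]` kills the Γ-ideal by `exists_ringHom_away`;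
  `exists_ringHom_cone_to_chart`: `y ↦ (a₀₀,…,a₂₃)` kills the cone `= x_{(e₀,c₀,c₃)}`;
  `comp_eq_id_cone`, `comp_eq_id_chart`: both composites are identities because
  `a₀₃, a₁₂, a₂₁, a₀₀a₁₁ - a₀₁a₁₀, a₀₂a₂₀ - a₀₀a₂₂` are, up to sign, minors in `Γ`);
* `isDomain_chart`, `not_isRegularRing_chart` — hence `L` is a domain and not a regular ring
  (`isDomain_cone_away`, `not_isRegularRing_cone_away` of `…ResidueWitnessCone.lean`).

The computation is split into small declarations on purpose (ring identities in an abstract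
commutative ring: `cone_point_relations`, `solve_entry`, `solve_entry'`), each within the default
heartbeat budget. No definition and no notation is declared. Folklore throughout.
-/

noncomputable section

-- single-problem summit: the doubled namespace component `ResolutionOfSingularities` is forced
set_option linter.dupNamespace false

open MvPolynomial Literature.AlgebraicGeometry.Resolution

namespace Summit.ResolutionOfSingularities.ResolutionOfSingularities.Theorems.MatroidCellRes

variable {K : Type} [Field K]

/-! ## The chart ring `(K[A] ⧸ (x_u : u ∈ Γ))[1/a₀₀]` is the localised cone ring -/

/-- Three identities in any commutative ring (the images of the three quadratic line relations
under `A ↦ [[t₀,t₁,t₂,0],[t₃,t₁t₃w,0,t₄],[t₅,0,t₂t₅w,t₆]]`, `t₀w = 1`, `t₃t₆ = t₄t₅`). [folklore] -/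
theorem cone_point_relations {A : Type*} [CommRing A] (t0 t1 t2 t3 t4 t5 t6 w : A)
    (htw : t0 * w = 1) (hq : t3 * t6 - t4 * t5 = 0) :
    t0 * (t1 * t3 * w) - t1 * t3 = 0 ∧ t2 * t5 - t0 * (t2 * t5 * w) = 0 ∧ t3 * t6 - t4 * t5 = 0 :=
  ⟨by linear_combination (t1 * t3) * htw, by linear_combination (-(t2 * t5)) * htw, hq⟩

/-- `l₀₁l₁₀u = l₁₁` from `l₀₀l₁₁ = l₀₁l₁₀` and `l₀₀u = 1`, in any commutative ring. [folklore] -/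
theorem solve_entry {A : Type*} [CommRing A] (l00 l01 l10 l11 u : A)
    (r : l00 * l11 - l01 * l10 = 0) (hu : l00 * u = 1) : l01 * l10 * u = l11 := by
  linear_combination (-u) * r + l11 * hu

/-- `l₀₁l₁₀u = l₁₁` from `l₀₁l₁₀ = l₀₀l₁₁` and `l₀₀u = 1`, in any commutative ring. [folklore] -/
theorem solve_entry' {A : Type*} [CommRing A] (l00 l01 l10 l11 u : A)
    (r : l01 * l10 - l00 * l11 = 0) (hu : l00 * u = 1) : l01 * l10 * u = l11 := by
  linear_combination u * r + l11 * hu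

/-- **The map `(K[A] ⧸ I)[1/a₀₀] → (K[y] ⧸ (y₃y₆ - y₄y₅))[1/y₀]` on generators**: if `I` has the
factorisation property, there is a ring map sending `A ↦ [[y₀,y₁,y₂,0],[y₃,y₁y₃w,0,y₄],[y₅,0,y₂y₅w,y₆]]`
(`w = 1/y₀`) and constants to constants. [folklore] -/
theorem exists_ringHom_chart_to_cone (q : MvPolynomial (Fin 7) K)
    (hq : q = X 3 * X 6 - X 4 * X 5) (J : Ideal (MvPolynomial (Fin 7) K)) (hJ : J = Ideal.span {q})
    (I : Ideal (MvPolynomial (Fin 3 × Fin 4) K))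
    (hI : ∀ (P : Fin 3 → Fin 4 → (Localization.Away (Ideal.Quotient.mk J (X 0)))),
      P 0 0 * P 1 1 - P 0 1 * P 1 0 = 0 → P 0 2 * P 2 0 - P 0 0 * P 2 2 = 0 →
      P 1 0 * P 2 3 - P 1 3 * P 2 0 = 0 → P 2 1 = 0 → P 1 2 = 0 → P 0 3 = 0 → IsUnit (P 0 0) →
      ∃ φ : (Localization.Away (Ideal.Quotient.mk I (X (0, 0)))) →+* (Localization.Away (Ideal.Quotient.mk J (X 0))),
        ∀ f, φ (algebraMap (MvPolynomial (Fin 3 × Fin 4) K ⧸ I) (Localization.Away (Ideal.Quotient.mk I (X (0, 0)))) (Ideal.Quotient.mk I f)) =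
          aeval (fun ij : Fin 3 × Fin 4 => P ij.1 ij.2) f)
    (t : Fin 7 → (Localization.Away (Ideal.Quotient.mk J (X 0)))) (ht : ∀ k, t k = algebraMap _ (Localization.Away (Ideal.Quotient.mk J (X 0))) (Ideal.Quotient.mk J (X k)))
    (w : (Localization.Away (Ideal.Quotient.mk J (X 0)))) (htw : t 0 * w = 1) :
    ∃ φ : (Localization.Away (Ideal.Quotient.mk I (X (0, 0)))) →+* (Localization.Away (Ideal.Quotient.mk J (X 0))),
      (∀ i j, φ (algebraMap (MvPolynomial (Fin 3 × Fin 4) K ⧸ I) (Localization.Away (Ideal.Quotient.mk I (X (0, 0)))) (Ideal.Quotient.mk I (X (i, j)))) =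
        (![![t 0, t 1, t 2, 0], ![t 3, t 1 * t 3 * w, 0, t 4], ![t 5, 0, t 2 * t 5 * w, t 6]] : Fin 3 → Fin 4 → (Localization.Away (Ideal.Quotient.mk J (X 0)))) i j) ∧
      ∀ r : K, φ (algebraMap (MvPolynomial (Fin 3 × Fin 4) K ⧸ I) (Localization.Away (Ideal.Quotient.mk I (X (0, 0)))) (Ideal.Quotient.mk I (C r))) =
        algebraMap _ (Localization.Away (Ideal.Quotient.mk J (X 0))) (Ideal.Quotient.mk J (C r)) := by
  have hqD : t 3 * t 6 - t 4 * t 5 = 0 := by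
    have hqJ : q ∈ J := hJ ▸ Ideal.mem_span_singleton_self q
    have h : algebraMap _ (Localization.Away (Ideal.Quotient.mk J (X 0))) (Ideal.Quotient.mk J (X 3 * X 6 - X 4 * X 5)) = 0 := by
      rw [← hq, Ideal.Quotient.eq_zero_iff_mem.mpr hqJ, map_zero]
    rw [map_sub, map_mul, map_mul, map_sub, map_mul, map_mul, ← ht, ← ht, ← ht, ← ht] at h
    exact h
  obtain ⟨l₁, l₂, l₃⟩ := cone_point_relations (t 0) (t 1) (t 2) (t 3) (t 4) (t 5) (t 6) w htw hqD
  have h00 : IsUnit (t 0) := by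
    rw [ht]
    exact IsLocalization.Away.algebraMap_isUnit (Ideal.Quotient.mk J (X 0))
  obtain ⟨φ, hφ⟩ := hI (![![t 0, t 1, t 2, 0], ![t 3, t 1 * t 3 * w, 0, t 4], ![t 5, 0, t 2 * t 5 * w, t 6]] : Fin 3 → Fin 4 → (Localization.Away (Ideal.Quotient.mk J (X 0))))
    (by simp only [Matrix.cons_val]; exact l₁) (by simp only [Matrix.cons_val]; exact l₂) (by simp only [Matrix.cons_val]; exact l₃)
    (by simp only [Matrix.cons_val]) (by simp only [Matrix.cons_val]) (by simp only [Matrix.cons_val]) (by simp only [Matrix.cons_val]; exact h00)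
  refine ⟨φ, fun i j => ?_, fun r => ?_⟩
  · rw [hφ, aeval_X]
  · rw [hφ, aeval_C, algebraMap_away_mk_C]

/-- The composite `φ ∘ ψ` on the cone side is the identity (check on `y₀,…,y₆` and constants).
[folklore] -/
theorem comp_eq_id_cone (J : Ideal (MvPolynomial (Fin 7) K)) (I : Ideal (MvPolynomial (Fin 3 × Fin 4) K))
    (t : Fin 7 → (Localization.Away (Ideal.Quotient.mk J (X 0)))) (ht : ∀ k, t k = algebraMap _ (Localization.Away (Ideal.Quotient.mk J (X 0))) (Ideal.Quotient.mk J (X k)))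
    (w : (Localization.Away (Ideal.Quotient.mk J (X 0)))) (φ : (Localization.Away (Ideal.Quotient.mk I (X (0, 0)))) →+* (Localization.Away (Ideal.Quotient.mk J (X 0)))) (ψ : (Localization.Away (Ideal.Quotient.mk J (X 0))) →+* (Localization.Away (Ideal.Quotient.mk I (X (0, 0)))))
    (hφX : ∀ i j, φ (algebraMap (MvPolynomial (Fin 3 × Fin 4) K ⧸ I) (Localization.Away (Ideal.Quotient.mk I (X (0, 0))))
      (Ideal.Quotient.mk I (X (i, j)))) = (![![t 0, t 1, t 2, 0], ![t 3, t 1 * t 3 * w, 0, t 4], ![t 5, 0, t 2 * t 5 * w, t 6]] : Fin 3 → Fin 4 → (Localization.Away (Ideal.Quotient.mk J (X 0)))) i j)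
    (hφC : ∀ r : K, φ (algebraMap (MvPolynomial (Fin 3 × Fin 4) K ⧸ I) (Localization.Away (Ideal.Quotient.mk I (X (0, 0))))
      (Ideal.Quotient.mk I (C r))) = algebraMap _ (Localization.Away (Ideal.Quotient.mk J (X 0))) (Ideal.Quotient.mk J (C r)))
    (hψt : ∀ k, ψ (algebraMap _ (Localization.Away (Ideal.Quotient.mk J (X 0))) (Ideal.Quotient.mk J (X k))) =
      algebraMap (MvPolynomial (Fin 3 × Fin 4) K ⧸ I) (Localization.Away (Ideal.Quotient.mk I (X (0, 0)))) (Ideal.Quotient.mk I (X ((![((0 : Fin 3), (0 : Fin 4)), (0, 1), (0, 2), (1, 0), (1, 3), (2, 0), (2, 3)] : Fin 7 → Fin 3 × Fin 4) k))))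
    (hψC : ∀ r : K, ψ (algebraMap _ (Localization.Away (Ideal.Quotient.mk J (X 0))) (Ideal.Quotient.mk J (C r))) =
      algebraMap K (Localization.Away (Ideal.Quotient.mk I (X (0, 0)))) r) :
    φ.comp ψ = RingHom.id _ := by
  have c : ∀ k : Fin 7, ∀ ij : Fin 3 × Fin 4,
      algebraMap (MvPolynomial (Fin 3 × Fin 4) K ⧸ I) (Localization.Away (Ideal.Quotient.mk I (X (0, 0)))) (Ideal.Quotient.mk I (X ((![((0 : Fin 3), (0 : Fin 4)), (0, 1), (0, 2), (1, 0), (1, 3), (2, 0), (2, 3)] : Fin 7 → Fin 3 × Fin 4) k))) =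
        algebraMap (MvPolynomial (Fin 3 × Fin 4) K ⧸ I) (Localization.Away (Ideal.Quotient.mk I (X (0, 0)))) (Ideal.Quotient.mk I (X ij)) →
      (![![t 0, t 1, t 2, 0], ![t 3, t 1 * t 3 * w, 0, t 4], ![t 5, 0, t 2 * t 5 * w, t 6]] : Fin 3 → Fin 4 → (Localization.Away (Ideal.Quotient.mk J (X 0)))) ij.1 ij.2 = t k →
      φ (ψ (algebraMap _ (Localization.Away (Ideal.Quotient.mk J (X 0))) (Ideal.Quotient.mk J (X k)))) =
        algebraMap _ (Localization.Away (Ideal.Quotient.mk J (X 0))) (Ideal.Quotient.mk J (X k)) := by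
    rintro k ⟨i, j⟩ h1 h2
    rw [hψt, h1, hφX, h2, ht]
  refine ringHom_ext_away_mk J (X 0) (fun k => ?_) (fun r => ?_)
  · fin_cases k
    · exact c 0 (0, 0) (by simp only [Matrix.cons_val]) (by simp only [Matrix.cons_val])
    · exact c 1 (0, 1) (by simp only [Matrix.cons_val]) (by simp only [Matrix.cons_val])
    · exact c 2 (0, 2) (by simp only [Matrix.cons_val]) (by simp only [Matrix.cons_val])
    · exact c 3 (1, 0) (by simp only [Matrix.cons_val]) (by simp only [Matrix.cons_val])
    · exact c 4 (1, 3) (by simp only [Matrix.cons_val]) (by simp only [Matrix.cons_val])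
    · exact c 5 (2, 0) (by simp only [Matrix.cons_val]) (by simp only [Matrix.cons_val])
    · exact c 6 (2, 3) (by simp only [Matrix.cons_val]) (by simp only [Matrix.cons_val])
  · show φ (ψ (algebraMap _ _ (Ideal.Quotient.mk J (C r)))) = _
    rw [hψC, algebraMap_away_mk_C, hφC]
    rfl

/-- The composite `ψ ∘ φ` on the chart side is the identity (check on the `a_ij` and constants).
[folklore] -/
theorem comp_eq_id_chart (J : Ideal (MvPolynomial (Fin 7) K)) (I : Ideal (MvPolynomial (Fin 3 × Fin 4) K))
    (ℓ : MvPolynomial (Fin 3 × Fin 4) K →+* (Localization.Away (Ideal.Quotient.mk I (X (0, 0)))))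
    (hℓ : ∀ f, ℓ f = algebraMap (MvPolynomial (Fin 3 × Fin 4) K ⧸ I) (Localization.Away (Ideal.Quotient.mk I (X (0, 0)))) (Ideal.Quotient.mk I f))
    (r₄ : ℓ (X (2, 1)) = 0) (r₅ : ℓ (X (1, 2)) = 0) (r₆ : ℓ (X (0, 3)) = 0)
    (t : Fin 7 → (Localization.Away (Ideal.Quotient.mk J (X 0)))) (w : (Localization.Away (Ideal.Quotient.mk J (X 0)))) (φ : (Localization.Away (Ideal.Quotient.mk I (X (0, 0)))) →+* (Localization.Away (Ideal.Quotient.mk J (X 0)))) (ψ : (Localization.Away (Ideal.Quotient.mk J (X 0))) →+* (Localization.Away (Ideal.Quotient.mk I (X (0, 0)))))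
    (hφX : ∀ i j, φ (algebraMap (MvPolynomial (Fin 3 × Fin 4) K ⧸ I) (Localization.Away (Ideal.Quotient.mk I (X (0, 0))))
      (Ideal.Quotient.mk I (X (i, j)))) = (![![t 0, t 1, t 2, 0], ![t 3, t 1 * t 3 * w, 0, t 4], ![t 5, 0, t 2 * t 5 * w, t 6]] : Fin 3 → Fin 4 → (Localization.Away (Ideal.Quotient.mk J (X 0)))) i j)
    (hφC : ∀ r : K, φ (algebraMap (MvPolynomial (Fin 3 × Fin 4) K ⧸ I) (Localization.Away (Ideal.Quotient.mk I (X (0, 0))))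
      (Ideal.Quotient.mk I (C r))) = algebraMap _ (Localization.Away (Ideal.Quotient.mk J (X 0))) (Ideal.Quotient.mk J (C r)))
    (s0 : ψ (t 0) = ℓ (X (0, 0))) (s1 : ψ (t 1) = ℓ (X (0, 1))) (s2 : ψ (t 2) = ℓ (X (0, 2)))
    (s3 : ψ (t 3) = ℓ (X (1, 0))) (s4 : ψ (t 4) = ℓ (X (1, 3))) (s5 : ψ (t 5) = ℓ (X (2, 0)))
    (s6 : ψ (t 6) = ℓ (X (2, 3)))
    (e₁ : ℓ (X (0, 1)) * ℓ (X (1, 0)) * ψ w = ℓ (X (1, 1)))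
    (e₂ : ℓ (X (0, 2)) * ℓ (X (2, 0)) * ψ w = ℓ (X (2, 2)))
    (hψC : ∀ r : K, ψ (algebraMap _ (Localization.Away (Ideal.Quotient.mk J (X 0))) (Ideal.Quotient.mk J (C r))) =
      algebraMap K (Localization.Away (Ideal.Quotient.mk I (X (0, 0)))) r) :
    ψ.comp φ = RingHom.id _ := by
  have d : ∀ (i : Fin 3) (j : Fin 4) (x : (Localization.Away (Ideal.Quotient.mk J (X 0)))), (![![t 0, t 1, t 2, 0], ![t 3, t 1 * t 3 * w, 0, t 4], ![t 5, 0, t 2 * t 5 * w, t 6]] : Fin 3 → Fin 4 → (Localization.Away (Ideal.Quotient.mk J (X 0)))) i j = x → ψ x = ℓ (X (i, j)) →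
      ψ (φ (algebraMap _ (Localization.Away (Ideal.Quotient.mk I (X (0, 0)))) (Ideal.Quotient.mk I (X (i, j))))) =
        algebraMap _ (Localization.Away (Ideal.Quotient.mk I (X (0, 0)))) (Ideal.Quotient.mk I (X (i, j))) := by
    intro i j x h1 h2
    rw [hφX, h1, h2, hℓ]
  have z : ψ 0 = 0 := map_zero ψ
  have d11 : ψ (t 1 * t 3 * w) = ℓ (X (1, 1)) := by rw [map_mul, map_mul, s1, s3]; exact e₁
  have d22 : ψ (t 2 * t 5 * w) = ℓ (X (2, 2)) := by rw [map_mul, map_mul, s2, s5]; exact e₂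
  refine ringHom_ext_away_mk I (X (0, 0)) ?_ (fun r => ?_)
  · rintro ⟨i, j⟩
    fin_cases i <;> fin_cases j
    · exact d 0 0 _ (by simp only [Matrix.cons_val]) s0
    · exact d 0 1 _ (by simp only [Matrix.cons_val]) s1
    · exact d 0 2 _ (by simp only [Matrix.cons_val]) s2
    · exact d 0 3 _ (by simp only [Matrix.cons_val]) (z.trans r₆.symm)
    · exact d 1 0 _ (by simp only [Matrix.cons_val]) s3
    · exact d 1 1 _ (by simp only [Matrix.cons_val]) d11
    · exact d 1 2 _ (by simp only [Matrix.cons_val]) (z.trans r₅.symm)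
    · exact d 1 3 _ (by simp only [Matrix.cons_val]) s4
    · exact d 2 0 _ (by simp only [Matrix.cons_val]) s5
    · exact d 2 1 _ (by simp only [Matrix.cons_val]) (z.trans r₄.symm)
    · exact d 2 2 _ (by simp only [Matrix.cons_val]) d22
    · exact d 2 3 _ (by simp only [Matrix.cons_val]) s6
  · show ψ (φ (algebraMap _ _ (Ideal.Quotient.mk I (C r)))) = _
    rw [hφC, hψC, algebraMap_away_mk_C]
    rfl

/-- **The map `(K[y] ⧸ (y₃y₆ - y₄y₅))[1/y₀] → (K[A] ⧸ I)[1/a₀₀]`**, `y ↦ (a₀₀,a₀₁,a₀₂,a₁₀,a₁₃,a₂₀,a₂₃)`,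
exists as soon as `a₁₀a₂₃ - a₁₃a₂₀ ∈ I` (universal property of the cone ring). [folklore] -/
theorem exists_ringHom_cone_to_chart (q : MvPolynomial (Fin 7) K) (hq : q = X 3 * X 6 - X 4 * X 5)
    (J : Ideal (MvPolynomial (Fin 7) K)) (hJ : J = Ideal.span {q}) (I : Ideal (MvPolynomial (Fin 3 × Fin 4) K))
    (m₃ : (X (1, 0) * X (2, 3) - X (1, 3) * X (2, 0) : MvPolynomial (Fin 3 × Fin 4) K) ∈ I) :
    ∃ ψ : (Localization.Away (Ideal.Quotient.mk J (X 0))) →+* (Localization.Away (Ideal.Quotient.mk I (X (0, 0)))),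
      (∀ k, ψ (algebraMap _ (Localization.Away (Ideal.Quotient.mk J (X 0))) (Ideal.Quotient.mk J (X k))) =
        algebraMap (MvPolynomial (Fin 3 × Fin 4) K ⧸ I) (Localization.Away (Ideal.Quotient.mk I (X (0, 0)))) (Ideal.Quotient.mk I (X ((![((0 : Fin 3), (0 : Fin 4)), (0, 1), (0, 2), (1, 0), (1, 3), (2, 0), (2, 3)] : Fin 7 → Fin 3 × Fin 4) k)))) ∧
      (∀ r : K, ψ (algebraMap _ (Localization.Away (Ideal.Quotient.mk J (X 0))) (Ideal.Quotient.mk J (C r))) =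
        algebraMap K (Localization.Away (Ideal.Quotient.mk I (X (0, 0)))) r) ∧
      algebraMap (MvPolynomial (Fin 3 × Fin 4) K ⧸ I) (Localization.Away (Ideal.Quotient.mk I (X (0, 0)))) (Ideal.Quotient.mk I (X (0, 0))) *
        ψ (IsLocalization.Away.invSelf (Ideal.Quotient.mk J (X 0))) = 1 := by
  subst hJ
  obtain ⟨ℓ, hℓ⟩ : ∃ ℓ : MvPolynomial (Fin 3 × Fin 4) K →+* (Localization.Away (Ideal.Quotient.mk I (X (0, 0)))),
      ∀ f, ℓ f = algebraMap (MvPolynomial (Fin 3 × Fin 4) K ⧸ I) (Localization.Away (Ideal.Quotient.mk I (X (0, 0)))) (Ideal.Quotient.mk I f) :=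
    ⟨(algebraMap (MvPolynomial (Fin 3 × Fin 4) K ⧸ I) (Localization.Away (Ideal.Quotient.mk I (X (0, 0))))).comp (Ideal.Quotient.mk I),
      fun f => RingHom.comp_apply _ _ f⟩
  have r₃ : ℓ (X (1, 0)) * ℓ (X (2, 3)) - ℓ (X (1, 3)) * ℓ (X (2, 0)) = 0 := by
    have h : ℓ (X (1, 0) * X (2, 3) - X (1, 3) * X (2, 0)) = 0 := by
      rw [hℓ, Ideal.Quotient.eq_zero_iff_mem.mpr m₃, map_zero]
    rwa [map_sub, map_mul, map_mul] at h
  have hunitL : IsUnit (ℓ (X (0, 0))) := by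
    rw [hℓ]
    exact IsLocalization.Away.algebraMap_isUnit (Ideal.Quotient.mk I (X (0, 0)))
  obtain ⟨ψ, hψt, hψC, hψw⟩ := exists_ringHom_cone_away (S := (Localization.Away (Ideal.Quotient.mk I (X (0, 0))))) q hq
    (fun k : Fin 7 => ℓ (X ((![((0 : Fin 3), (0 : Fin 4)), (0, 1), (0, 2), (1, 0), (1, 3), (2, 0), (2, 3)] : Fin 7 → Fin 3 × Fin 4) k)))
    (by simp only [Matrix.cons_val]; exact r₃) (by simp only [Matrix.cons_val]; exact hunitL)
  refine ⟨ψ, fun k => ?_, hψC, ?_⟩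
  · rw [hψt, hℓ]
  · rw [← hℓ]
    simpa only [Matrix.cons_val] using hψw

/-- The two remaining quadratic line relations in `(K[A] ⧸ I)[1/a₀₀]`. [folklore] -/
theorem chart_relations (I : Ideal (MvPolynomial (Fin 3 × Fin 4) K))
    (m₁ : (X (0, 0) * X (1, 1) - X (0, 1) * X (1, 0) : MvPolynomial (Fin 3 × Fin 4) K) ∈ I)
    (m₂ : (X (0, 2) * X (2, 0) - X (0, 0) * X (2, 2) : MvPolynomial (Fin 3 × Fin 4) K) ∈ I)
    (ℓ : MvPolynomial (Fin 3 × Fin 4) K →+* (Localization.Away (Ideal.Quotient.mk I (X (0, 0)))))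
    (hℓ : ∀ f, ℓ f = algebraMap (MvPolynomial (Fin 3 × Fin 4) K ⧸ I) (Localization.Away (Ideal.Quotient.mk I (X (0, 0)))) (Ideal.Quotient.mk I f)) :
    ℓ (X (0, 0)) * ℓ (X (1, 1)) - ℓ (X (0, 1)) * ℓ (X (1, 0)) = 0 ∧
      ℓ (X (0, 2)) * ℓ (X (2, 0)) - ℓ (X (0, 0)) * ℓ (X (2, 2)) = 0 := by
  have hℓ0 : ∀ f ∈ I, ℓ f = 0 := fun f hf => by
    rw [hℓ, Ideal.Quotient.eq_zero_iff_mem.mpr hf, map_zero]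
  constructor
  · have h := hℓ0 _ m₁; rwa [map_sub, map_mul, map_mul] at h
  · have h := hℓ0 _ m₂; rwa [map_sub, map_mul, map_mul] at h

/-- **Abstract form of the chart computation.** Let `I ⊆ K[A]` be an ideal containing
`a₀₀a₁₁ - a₀₁a₁₀, a₀₂a₂₀ - a₀₀a₂₂, a₁₀a₂₃ - a₁₃a₂₀, a₂₁, a₁₂, a₀₃` and such that every evaluation
`A ↦ P` at which these six vanish and `P₀₀` is a unit factors through `(K[A] ⧸ I)[1/a₀₀]`. Then
`(K[A] ⧸ I)[1/a₀₀] ≃+* (K[y₀,…,y₆] ⧸ (y₃y₆ - y₄y₅))[1/y₀]`: `A ↦ [[y₀,y₁,y₂,0],[y₃,y₁y₃/y₀,0,y₄],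
[y₅,0,y₂y₅/y₀,y₆]]` and `y ↦ (a₀₀,a₀₁,a₀₂,a₁₀,a₁₃,a₂₀,a₂₃)` are mutually inverse. [folklore] -/
theorem nonempty_ringEquiv_away_cone_of (q : MvPolynomial (Fin 7) K)
    (hq : q = X 3 * X 6 - X 4 * X 5) (J : Ideal (MvPolynomial (Fin 7) K)) (hJ : J = Ideal.span {q})
    (I : Ideal (MvPolynomial (Fin 3 × Fin 4) K))
    (m₁ : (X (0, 0) * X (1, 1) - X (0, 1) * X (1, 0) : MvPolynomial (Fin 3 × Fin 4) K) ∈ I)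
    (m₂ : (X (0, 2) * X (2, 0) - X (0, 0) * X (2, 2) : MvPolynomial (Fin 3 × Fin 4) K) ∈ I)
    (m₃ : (X (1, 0) * X (2, 3) - X (1, 3) * X (2, 0) : MvPolynomial (Fin 3 × Fin 4) K) ∈ I)
    (m₄ : (X (2, 1) : MvPolynomial (Fin 3 × Fin 4) K) ∈ I)
    (m₅ : (X (1, 2) : MvPolynomial (Fin 3 × Fin 4) K) ∈ I)
    (m₆ : (X (0, 3) : MvPolynomial (Fin 3 × Fin 4) K) ∈ I)
    (hI : ∀ (P : Fin 3 → Fin 4 → (Localization.Away (Ideal.Quotient.mk J (X 0)))),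
      P 0 0 * P 1 1 - P 0 1 * P 1 0 = 0 → P 0 2 * P 2 0 - P 0 0 * P 2 2 = 0 →
      P 1 0 * P 2 3 - P 1 3 * P 2 0 = 0 → P 2 1 = 0 → P 1 2 = 0 → P 0 3 = 0 → IsUnit (P 0 0) →
      ∃ φ : (Localization.Away (Ideal.Quotient.mk I (X (0, 0)))) →+* (Localization.Away (Ideal.Quotient.mk J (X 0))),
        ∀ f, φ (algebraMap (MvPolynomial (Fin 3 × Fin 4) K ⧸ I) (Localization.Away (Ideal.Quotient.mk I (X (0, 0)))) (Ideal.Quotient.mk I f)) =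
          aeval (fun ij : Fin 3 × Fin 4 => P ij.1 ij.2) f) :
    Nonempty ((Localization.Away (Ideal.Quotient.mk I (X (0, 0)))) ≃+* (Localization.Away (Ideal.Quotient.mk J (X 0)))) := by
  -- `ℓ : K[A] → L`, and the relations in `L`
  obtain ⟨ℓ, hℓ⟩ : ∃ ℓ : MvPolynomial (Fin 3 × Fin 4) K →+* (Localization.Away (Ideal.Quotient.mk I (X (0, 0)))),
      ∀ f, ℓ f = algebraMap (MvPolynomial (Fin 3 × Fin 4) K ⧸ I) (Localization.Away (Ideal.Quotient.mk I (X (0, 0)))) (Ideal.Quotient.mk I f) :=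
    ⟨(algebraMap (MvPolynomial (Fin 3 × Fin 4) K ⧸ I) (Localization.Away (Ideal.Quotient.mk I (X (0, 0))))).comp (Ideal.Quotient.mk I),
      fun f => RingHom.comp_apply _ _ f⟩
  have hℓ0 : ∀ f ∈ I, ℓ f = 0 := fun f hf => by
    rw [hℓ, Ideal.Quotient.eq_zero_iff_mem.mpr hf, map_zero]
  obtain ⟨r₁, r₂⟩ := chart_relations I m₁ m₂ ℓ hℓ
  -- `ψ : D → L` and `φ : L → D`
  obtain ⟨ψ, hψt, hψC, hψw⟩ := exists_ringHom_cone_to_chart q hq J hJ I m₃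
  obtain ⟨t, ht⟩ : ∃ t : Fin 7 → (Localization.Away (Ideal.Quotient.mk J (X 0))),
      ∀ k, t k = algebraMap _ (Localization.Away (Ideal.Quotient.mk J (X 0))) (Ideal.Quotient.mk J (X k)) := ⟨_, fun k => rfl⟩
  obtain ⟨w, hw, htw⟩ : ∃ w : (Localization.Away (Ideal.Quotient.mk J (X 0))),
      w = IsLocalization.Away.invSelf (Ideal.Quotient.mk J (X 0)) ∧ t 0 * w = 1 :=
    ⟨_, rfl, by rw [ht]; exact IsLocalization.Away.mul_invSelf _⟩
  obtain ⟨φ, hφX, hφC⟩ := exists_ringHom_chart_to_cone q hq J hJ I hI t ht w htw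
  -- the values `ψ (t k)`, `ψ w`
  have s0 : ψ (t 0) = ℓ (X (0, 0)) := by rw [ht, hψt, hℓ]; simp only [Matrix.cons_val]
  have s1 : ψ (t 1) = ℓ (X (0, 1)) := by rw [ht, hψt, hℓ]; simp only [Matrix.cons_val]
  have s2 : ψ (t 2) = ℓ (X (0, 2)) := by rw [ht, hψt, hℓ]; simp only [Matrix.cons_val]
  have s3 : ψ (t 3) = ℓ (X (1, 0)) := by rw [ht, hψt, hℓ]; simp only [Matrix.cons_val]
  have s4 : ψ (t 4) = ℓ (X (1, 3)) := by rw [ht, hψt, hℓ]; simp only [Matrix.cons_val]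
  have s5 : ψ (t 5) = ℓ (X (2, 0)) := by rw [ht, hψt, hℓ]; simp only [Matrix.cons_val]
  have s6 : ψ (t 6) = ℓ (X (2, 3)) := by rw [ht, hψt, hℓ]; simp only [Matrix.cons_val]
  have hψw' : ℓ (X (0, 0)) * ψ w = 1 := by rw [hℓ, hw]; exact hψw
  have h₁ := comp_eq_id_cone J I t ht w φ ψ hφX hφC hψt hψC
  have h₂ := comp_eq_id_chart J I ℓ hℓ (hℓ0 _ m₄) (hℓ0 _ m₅) (hℓ0 _ m₆) t w φ ψ hφX hφC
    s0 s1 s2 s3 s4 s5 s6 (solve_entry _ _ _ _ _ r₁ hψw') (solve_entry' _ _ _ _ _ r₂ hψw') hψC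
  exact ⟨RingEquiv.ofRingHom φ ψ h₁ h₂⟩

/-- **The chart `D(a₀₀)` of the complete-quadrilateral Γ-scheme is the cone**:
`(K[A] ⧸ (x_u : u ∈ Γ))[1/a₀₀] ≃+* (K[y₀,…,y₆] ⧸ (y₃y₆ - y₄y₅))[1/y₀]`, `Γ = {u | x_u(A₀) = 0}`
(`nonempty_ringEquiv_away_cone_of`: the six generators are, up to sign, the line minors, which lie
in the Γ-ideal because they vanish at `A₀`; the factorisation property is `exists_ringHom_away`).
[folklore] -/
theorem nonempty_ringEquiv_chart_cone (h2 : (2 : K) ≠ 0) :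
    Nonempty (Localization.Away (Ideal.Quotient.mk (HuGamma.ideal K 4
        {u | aeval (fun ij : Fin 3 × Fin 4 =>
        (![![(1 : K), 1, 1, 0], ![1, 1, 0, 1], ![1, 0, 1, 1]] : Fin 3 → Fin 4 → K) ij.1 ij.2) (HuGamma.minor K 4 u) = 0}) (X (0, 0))) ≃+* (Localization.Away (Ideal.Quotient.mk (Ideal.span {(X 3 * X 6 - X 4 * X 5 : MvPolynomial (Fin 7) K)}) (X 0)))) := by
  have memI : ∀ u : Fin 3 → Fin 3 ⊕ Fin 4, aeval (fun ij : Fin 3 × Fin 4 =>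
        (![![(1 : K), 1, 1, 0], ![1, 1, 0, 1], ![1, 0, 1, 1]] : Fin 3 → Fin 4 → K) ij.1 ij.2) (HuGamma.minor K 4 u) = 0 →
      HuGamma.minor K 4 u ∈ HuGamma.ideal K 4 {u | aeval (fun ij : Fin 3 × Fin 4 =>
        (![![(1 : K), 1, 1, 0], ![1, 1, 0, 1], ![1, 0, 1, 1]] : Fin 3 → Fin 4 → K) ij.1 ij.2) (HuGamma.minor K 4 u) = 0} :=
    fun u hu => Ideal.subset_span ⟨u, hu, rfl⟩
  refine nonempty_ringEquiv_away_cone_of _ rfl _ rfl _ ?_ ?_ ?_ ?_ ?_ ?_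
    (fun P l₁ l₂ l₃ l₄ l₅ l₆ h00 => exists_ringHom_away h2 P l₁ l₂ l₃ l₄ l₅ l₆ h00)
  · rw [← minor_l₁]; refine memI _ ?_; rw [minor_l₁]; simp
  · rw [← minor_l₂]; refine memI _ ?_; rw [minor_l₂]; simp
  · rw [← minor_l₃]; refine memI _ ?_; rw [minor_l₃]; simp
  · rw [← minor_l₄]; refine memI _ ?_; rw [minor_l₄]; simp
  · have h := memI ![Sum.inl 0, Sum.inl 2, Sum.inr 2] (by rw [minor_l₅]; simp)
    rw [minor_l₅] at h
    simpa using (Ideal.neg_mem_iff _).mp h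
  · rw [← minor_l₆]; refine memI _ ?_; rw [minor_l₆]; simp

/-- **The chart ring is a domain** (it is the localised cone ring). [folklore] -/
theorem isDomain_chart (h2 : (2 : K) ≠ 0) :
    IsDomain (Localization.Away (Ideal.Quotient.mk (HuGamma.ideal K 4
        {u | aeval (fun ij : Fin 3 × Fin 4 =>
        (![![(1 : K), 1, 1, 0], ![1, 1, 0, 1], ![1, 0, 1, 1]] : Fin 3 → Fin 4 → K) ij.1 ij.2) (HuGamma.minor K 4 u) = 0}) (X (0, 0)))) := by
  obtain ⟨e⟩ := nonempty_ringEquiv_chart_cone (K := K) h2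
  haveI := isDomain_cone_away (K := K)
  exact MulEquiv.isDomain _ e.toMulEquiv

/-- **The chart ring is not regular** (it is the localised cone ring, singular at the vertex).
[cite: Hartshorne1977, I Thm. 5.1] -/
theorem not_isRegularRing_chart (h2 : (2 : K) ≠ 0) :
    ¬ IsRegularRing (Localization.Away (Ideal.Quotient.mk (HuGamma.ideal K 4
        {u | aeval (fun ij : Fin 3 × Fin 4 =>
        (![![(1 : K), 1, 1, 0], ![1, 1, 0, 1], ![1, 0, 1, 1]] : Fin 3 → Fin 4 → K) ij.1 ij.2) (HuGamma.minor K 4 u) = 0}) (X (0, 0)))) := by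
  obtain ⟨e⟩ := nonempty_ringEquiv_chart_cone (K := K) h2
  intro h
  haveI := h
  exact not_isRegularRing_cone_away (K := K) (IsRegularRing.of_ringEquiv e)

end Summit.ResolutionOfSingularities.ResolutionOfSingularities.Theorems.MatroidCellRes

end
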